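import Summits.ResolutionOfSingularities.ResolutionOfSingularities.Theses.DefectlessFrames

/-!
# Crux `ResidueTranscendenceReduction` (stmt-ResolutionOfSingularities-18875) — negative lemma: the conclusion ranges beyond the hypothesis

Route `ResolutionOfSingularities/DefectlessFrames`, crux `ResidueTranscendenceReduction := ∀ p prime,
HypA p → ConcB p`, where `HypA p` asks relative local uniformization only at valuation rings `O` that are
RANK ONE (`Nonempty O.valuation.RankOne`) and ZERO-DIMENSIONAL
(`∀ x ∈ O, ∃ f : k[X], f ≠ 0 ∧ f(x) ∈ O.nonunits`), while `ConcB p` asks it at every valuation ring over a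
perfect field.  `exists_conclusion_instance_outside_hypothesis` (cdisprove seat, cycle 1) exhibits, for
every prime `p`, data `(k, K, O)` in the range of the conclusion — `k = 𝔽_p` perfect, `K = 𝔽_p(t)` finitely
generated, `k ⊆ O` — at which BOTH extra hypotheses of `HypA` fail (`O = ⊤`, the trivial valuation ring:
rank one entails non-triviality; the residue field `𝔽_p(t)` is transcendental over `𝔽_p`).  Hence the crux
is not closed by specialising its hypothesis (`fun p hp hA k K … O hk => hA k K … O hk _ _` has unfillable
holes): the positive-dimensional and the non-rank-one valuation rings are genuine extra content — the rank
half is Novacoski–Spivakovsky (tree `NovacoskiSpivakovsky2014_holds`, rattack evidence `allLU_of_rankOneLU`),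
the dimension half is the open content.  Full analysis: `Cruxes/ResidueTranscendenceReduction/Disproof.lean`.
-/

set_option linter.dupNamespace false -- mandated namespace of this single-conjunct summit

namespace Summit.ResolutionOfSingularities.ResolutionOfSingularities.Theorems.ResidueTranscendenceReduction.Negative

/-- The trivial valuation ring of a field carries no rank-one structure (Mathlib's `Valuation.RankOne`
extends `Valuation.IsNontrivial`, and `ValuationSubring.eq_top_iff`). [folklore] -/
theorem not_nonempty_rankOne_top {K : Type} [Field K] :
    ¬ Nonempty (⊤ : ValuationSubring K).valuation.RankOne := by
  rintro ⟨hr⟩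
  exact (ValuationSubring.eq_top_iff (⊤ : ValuationSubring K)).mp rfl hr.toIsNontrivial

/-- An element of the non-units of the trivial valuation ring is zero. [folklore] -/
theorem eq_zero_of_mem_nonunits_top {K : Type} [Field K] {x : K}
    (h : x ∈ (⊤ : ValuationSubring K).nonunits) : x = 0 := by
  rw [ValuationSubring.mem_nonunits_iff] at h
  by_contra hx
  have hnt : ¬ (⊤ : ValuationSubring K).valuation.IsNontrivial :=
    (ValuationSubring.eq_top_iff (⊤ : ValuationSubring K)).mp rfl
  exact hnt ⟨x, ((⊤ : ValuationSubring K).valuation.ne_zero_iff).mpr hx, h.ne⟩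

/-- The trivial valuation ring of `𝔽_p(t)` is not zero-dimensional over `𝔽_p`: `t` is transcendental.
[folklore] -/
theorem not_zeroDim_top_ratFunc (p : ℕ) [Fact p.Prime] :
    ¬ (∀ x ∈ (⊤ : ValuationSubring (RatFunc (ZMod p))), ∃ f : Polynomial (ZMod p), f ≠ 0 ∧
        Polynomial.aeval x f ∈ (⊤ : ValuationSubring (RatFunc (ZMod p))).nonunits) := by
  intro h
  obtain ⟨f, hf0, hf⟩ := h RatFunc.X (ValuationSubring.mem_top _)
  have hf' := eq_zero_of_mem_nonunits_top hf
  rw [RatFunc.aeval_X_left_eq_algebraMap] at hf'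
  exact hf0 (RatFunc.algebraMap_injective (ZMod p) (by simpa using hf'))

/-- **RANGE LEMMA for `ResidueTranscendenceReduction`.** For every prime `p` there are data in the range of
the crux's conclusion — a perfect field `k` of characteristic `p`, a finitely generated extension `K/k`, a
valuation ring `O ⊇ k` of `K` — at which the two extra hypotheses of the crux's antecedent BOTH fail: `O`
is not rank one and not zero-dimensional.  Witness: `k = 𝔽_p`, `K = 𝔽_p(t)`, `O = ⊤`.  So the crux is not
provable by specialising its hypothesis; its content is the rank half (Novacoski–Spivakovsky, proved in
tree) plus the open dimension half. [folklore] -/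
theorem exists_conclusion_instance_outside_hypothesis (p : ℕ) (hp : p.Prime) :
    ∃ (k K : Type) (_ : Field k) (_ : CharP k p) (_ : PerfectField k) (_ : Field K) (_ : Algebra k K)
      (O : ValuationSubring K), (⊤ : IntermediateField k K).FG ∧ (∀ c : k, algebraMap k K c ∈ O) ∧
        ¬ Nonempty O.valuation.RankOne ∧
        ¬ (∀ x ∈ O, ∃ f : Polynomial k, f ≠ 0 ∧ Polynomial.aeval x f ∈ O.nonunits) := by
  haveI : Fact p.Prime := ⟨hp⟩
  exact ⟨ZMod p, RatFunc (ZMod p), inferInstance, inferInstance, PerfectField.ofFinite, inferInstance,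
    inferInstance, ⊤, ⟨{RatFunc.X}, by simp [RatFunc.adjoin_X]⟩, fun _ => ValuationSubring.mem_top _,
    not_nonempty_rankOne_top, not_zeroDim_top_ratFunc p⟩

end Summit.ResolutionOfSingularities.ResolutionOfSingularities.Theorems.ResidueTranscendenceReduction.Negative
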